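/-
Copyright (c) 2026. All rights reserved.
Released under Apache 2.0 license as described in the file LICENSE.
-/
import Literature.Probability.FitznerVanDerHofstad2017.NobleBoundsNDispatchStarL
import Literature.Probability.FitznerVanDerHofstad2017.NobleBoundsNLowF1
import Literature.Probability.FitznerVanDerHofstad2017.NobleBoundsNMidECut
import Literature.Probability.FitznerVanDerHofstad2017.NobleBoundsNMidEProper
import Literature.Probability.FitznerVanDerHofstad2017.NobleBoundsNMidEProperTZ
import Literature.Probability.FitznerVanDerHofstad2017.NobleBoundsNMidF1
import Literature.Probability.FitznerVanDerHofstad2017.NobleBoundsNEndC1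
import HarnessLib

/-!
# Fitzner–van der Hofstad (2017), general `N`: variant `F″` over a CLOSED lower level (the `hE★` cells)

[FvdH17] R. Fitzner, R. van der Hofstad, *Mean-field behavior for nearest-neighbor percolation in `d > 10`*,
Electron. J. Probab. **22** (2017) no. 43, arXiv:1506.07977v2: §6.1 (6.4), "Case a ≥ 2" × "Case b" and "Case
b = 1" (pp. 58–59), §5.1 (5.4) second and third terms (p. 48), (4.58)–(4.65) (pp. 41–43), App. B Tables
"A^{ι,a,b}" (p. 75), "B^{(2),ι,a,b}" rows `a ≥ 2` (p. 76; base-`u` reading, DIVERGENCE D76 of the b2b-lace packet).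

A middle junction `k = i₀ + 1 ≤ M` whose lower level `k` is CLOSED (`a_k = ★`) and whose upper level `k + 1` is a
`midE` level of variant `F″` (kind bit `true`, `t_k ≠ u_{k+1}`, hence exit class `a′ = 2` above by clause (8)), on
the pinned section `z_k = w_k` (`JFacts.pin_closedL`).  The lower level owns no active slot
(`NobleBoundsNLowStar.jClosedL_not_act_lo`), so every row is the corresponding row `a = 2` of the open case
(`NobleBoundsNMidECut`, `NobleBoundsNMidEProperTZ`, `NobleBoundsNMidEProper`) with the exit line of level `k`
replaced by the trivially witnessed `{z_k ↔ w_k}` (witness `∅`; `genDisjOcc_triple_subset_quad`,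
`genDisjOcc_quad_subset_pent` below); the upper readings are unchanged (they never used the lower class).

* §0 the tool `genDisjOcc_quad_subset_pent` (adding a trivially witnessed fifth line);
* §A the readings of the cross letters on the upper lines only (`junF_lowECut_xb_le₃`, `junF_lowEP_xb_le₄`,
  `junF_lowEPT_xb_le₄`) and the parameter facts `JFacts.lowE_facts`;
* §B the three cores over a closed lower level (`nonempty_jPkg_lowECut_core`, `_lowEP_core`, `_lowEPT_core`) and
  the letter estimate `junF_lowEPT_mul_le` of the `d = 1` row;
* §C the cells: inner class `0` off the corner `w_{k+1} ~ t_k` (`nonempty_jPkg_lowE_cut`, `_cut_term₂'`; target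
  `δ_{z,t} A'^{κ,2,a′}(u,w,w′,t) P^{S,0}(u′−t,u′−t)`), inner class `1` (`_properTZ_two_two`, `_lit`; row
  `(≥2, ≥2 | d = 1)`), inner class `2` (`_proper_two_two`, `_lit`; row `(≥2, ≥2 | d ≥ 2)`);
* §D `nonempty_jPkg_lowE_slot` — the hypothesis `hE` of `NobleBoundsNDispatchStarL.nonempty_jPkg_mid_starL` in
  its literal shape, discharged up to the residual CORNER slot `hRS` (inner class `0`, `z_k = t_k = w_k`,
  `w_{k+1} ~ t_k`: the region `R` of DIVERGENCE D77, where row `(2, ≥2)` of Table "A" does not fit; nothing is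
  claimed there);
* §E `nonempty_jPkg_mid_starL'` — the lower-`★` pair package `tgtStarL … (τ i)` of a middle junction with the two
  `σ = true` slots of `nonempty_jPkg_mid_starL` discharged (`NobleBoundsNLowF1.nonempty_jPkg_lowF1_slot`,
  `nonempty_jPkg_lowE_slot`): the remaining HYPOTHESIS SLOTS are the two D77 residues over a closed level, `hR'`
  (`σ = false`, `a′ ≠ 0`, `w_{k+1} = t_k`: region `R′`) and `hRS` (`σ = true`, inner class `0`, `z_k = t_k = w_k`,
  `w_{k+1} ~ t_k`: region `R`).

Conventions: `d`-generic; nothing is cited as a fact; additive (no existing declaration is changed).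
-/

noncomputable section

open scoped ENNReal

namespace Literature.Probability.FitznerVanDerHofstad2017

open Literature.Barriers.CriticalPhenomena Literature.Probability.Percolation
open Literature.Probability.LatticeModels Literature.Combinatorics.SimpleGraph _root_.SimpleGraph
open _root_.MeasureTheory
open Literature.Probability.FitznerVanDerHofstad2017.NobleBlocks
open Literature.Probability.FitznerVanDerHofstad2017.NobleBlocks.LenIdx

variable {d : ℕ}

/-! ### 0. Adding a trivially witnessed fifth line -/

section Tools

/-- **Adding a trivially witnessed fifth line**: if `∅ ∈ E`, `⊛(A, B, C, D) ⊆ ⊛(A, B, C, D, E)` (witness `∅`).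
Twin of `genDisjOcc_triple_subset_quad`. [cite: FitznerVanDerHofstad2017, §4.2 Def. 4.1 (arXiv:1506.07977v2 p. 35)] -/
theorem genDisjOcc_quad_subset_pent {V : Type*} {k : ℕ} (A B C D E : Set (BondConfig V))
    (hE : (∅ : BondConfig V) ∈ E) (c₀ c₁ c₂ c₃ c₄ : Fin k) :
    genDisjOcc ![A, B, C, D] ![c₀, c₁, c₂, c₃] ⊆ genDisjOcc ![A, B, C, D, E] ![c₀, c₁, c₂, c₃, c₄] := by
  rintro ω ⟨K, hKω, hKA, hd⟩
  have h01 : Disjoint (K 0) (K 1) := hd (by decide)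
  have h02 : Disjoint (K 0) (K 2) := hd (by decide)
  have h03 : Disjoint (K 0) (K 3) := hd (by decide)
  have h12 : Disjoint (K 1) (K 2) := hd (by decide)
  have h13 : Disjoint (K 1) (K 3) := hd (by decide)
  have h23 : Disjoint (K 2) (K 3) := hd (by decide)
  refine ⟨![K 0, K 1, K 2, K 3, ∅], ?_, ?_, ?_⟩
  · intro i
    fin_cases i
    · exact hKω 0
    · exact hKω 1
    · exact hKω 2
    · exact hKω 3
    · exact Set.empty_subset _
  · intro i
    fin_cases i
    · exact hKA 0
    · exact hKA 1
    · exact hKA 2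
    · exact hKA 3
    · exact hE
  · intro i j hij
    fin_cases i <;> fin_cases j <;>
      first
      | exact absurd rfl hij
      | exact h01
      | exact h01.symm
      | exact h02
      | exact h02.symm
      | exact h03
      | exact h03.symm
      | exact h12
      | exact h12.symm
      | exact h13
      | exact h13.symm
      | exact h23
      | exact h23.symm
      | exact Set.disjoint_empty _
      | exact Set.empty_disjoint _

end Tools

/-! ### A. Readings on the upper lines and the parameter facts -/

section Letter

variable (p : unitInterval) (M : ℕ) (x : Site d) (b : Fin (M + 2) → Site d × Site d) (w t z : Fin (M + 2) → Site d)
  (a : Fin (M + 2) → Fin 3 ⊕ Unit) (τ : Fin (M + 1) → Bool × Fin 3)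

/-- **Three-line reading of the letter `xb` under `glMidS12`** over a `midE` level, upper lines only: bond (level
`k`), `b̄_k → w_{k+1}`, `w_{k+1} → t_k`. [cite: FitznerVanDerHofstad2017, §4.2 (4.18) (arXiv:1506.07977v2 p. 35); §6.1 (6.4) (p. 58)] -/
theorem junF_lowECut_xb_le₃ (i : Fin (M + 1)) (hσ : (τ i).1 = true) {a' : Fin 3} (ha' : a i.succ = Sum.inl a')
    (EB E0 E1 E2 E3 E4 X5 : Set (BondConfig (Site d))) :
    junF p M x b w t z a τ i.castSucc glMidS12 true false (midEv EB E0 E1 E2 E3 E4 X5) .xb ≤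
      piPerc d p 2 (genDisjOcc ![EB, E0, E1] ![0, 1, 1]) := by
  refine junF_le_of_lines p M x b w t z a τ i.castSucc glMidS12 true false _ JIdx.xb
    ![JIdx.xb, .up 0, .up 1] (by decide) (fun m => ?_) ![0, 1, 1] (fun m => by fin_cases m <;> rfl)
    ![EB, E0, E1] (by funext m; fin_cases m <;> rfl)
  fin_cases m
  · exact ⟨rfl, rfl⟩
  · exact ⟨(jMidE_act_up_iff M x b w t z a τ i hσ ha' true false 0).2 (by decide), rfl⟩
  · exact ⟨(jMidE_act_up_iff M x b w t z a τ i hσ ha' true false 1).2 (by decide), rfl⟩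

/-- **Four-line reading of the pentagon letter `xb` under `glMidP`**, upper lines only: bond (level `k`),
`b̄_k → w′`, `w′ → t`, `t ⇒ z` (level `k + 1`).
[cite: FitznerVanDerHofstad2017, §4.2 (4.18) (arXiv:1506.07977v2 p. 35); App. B Table "B^{(2),ι,a,b}" (p. 76)] -/
theorem junF_lowEP_xb_le₄ (i : Fin (M + 1)) (hσ : (τ i).1 = true) {a' : Fin 3} (ha' : a i.succ = Sum.inl a')
    (EB E0 E1 E2 E3 E4 X5 : Set (BondConfig (Site d))) :
    junF p M x b w t z a τ i.castSucc glMidP true false (midEv EB E0 E1 E2 E3 E4 X5) .xb ≤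
      piPerc d p 2 (genDisjOcc ![EB, E0, E1, E2] ![0, 1, 1, 1]) := by
  refine junF_le_of_lines p M x b w t z a τ i.castSucc glMidP true false _ JIdx.xb
    ![JIdx.xb, .up 0, .up 1, .up 2] (by decide) (fun m => ?_) ![0, 1, 1, 1]
    (fun m => by fin_cases m <;> rfl) ![EB, E0, E1, E2] (by funext m; fin_cases m <;> rfl)
  fin_cases m
  · exact ⟨rfl, rfl⟩
  · exact ⟨(jMidE_act_up_iff M x b w t z a τ i hσ ha' true false 0).2 (by decide), rfl⟩
  · exact ⟨(jMidE_act_up_iff M x b w t z a τ i hσ ha' true false 1).2 (by decide), rfl⟩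
  · exact ⟨(jMidE_act_up_iff M x b w t z a τ i hσ ha' true false 2).2 (by decide), rfl⟩

/-- **Four-line reading of the pentagon letter `xb` under `glMidPT`** (sausage-bond line switched on), upper lines
only: bond (level `k`), `b̄_k → w′`, `w′ → t`, `t — z` (level `k + 1`).
[cite: FitznerVanDerHofstad2017, §4.2 (4.18) (arXiv:1506.07977v2 p. 35); App. B Table "B^{(2),ι,a,b}" (p. 76)] -/
theorem junF_lowEPT_xb_le₄ (i : Fin (M + 1)) (hσ : (τ i).1 = true) {a' : Fin 3} (ha' : a i.succ = Sum.inl a')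
    (EB E0 E1 E2 E3 E4 X5 ET : Set (BondConfig (Site d))) :
    junF p M x b w t z a τ i.castSucc glMidPT true true (midEvT EB E0 E1 E2 E3 E4 X5 ET) .xb ≤
      piPerc d p 2 (genDisjOcc ![EB, E0, E1, E2] ![0, 1, 1, 1]) := by
  refine junF_le_of_lines p M x b w t z a τ i.castSucc glMidPT true true _ JIdx.xb
    ![JIdx.xb, .up 0, .up 1, .up 2] (by decide) (fun m => ?_) ![0, 1, 1, 1]
    (fun m => by fin_cases m <;> rfl) ![EB, E0, E1, E2] (by funext m; fin_cases m <;> rfl)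
  fin_cases m
  · exact ⟨rfl, rfl⟩
  · exact ⟨(jMidE_act_up_iff M x b w t z a τ i hσ ha' true true 0).2 (by decide), rfl⟩
  · exact ⟨(jMidE_act_up_iff M x b w t z a τ i hσ ha' true true 1).2 (by decide), rfl⟩
  · exact ⟨(jMidE_act_up_iff M x b w t z a τ i hσ ha' true true 2).2 (by decide), rfl⟩

end Letter

section Facts

variable (M : ℕ) (x : Site d) (b : Fin (M + 2) → Site d × Site d) (w t z : Fin (M + 2) → Site d)
  (a : Fin (M + 2) → Fin 3 ⊕ Unit) (c : Fin 3 ⊕ Unit) (τ : Fin (M + 1) → Bool × Fin 3)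

/-- The PARAMETER FACTS of a non-empty `F″` piece at a junction `k = i₀ + 1` over a closed level `k`, read off
`JFacts`: exit class `2` above (clause (8)), `z_k ≠ u_{k+1}`, `w_{k+1} ≠ t_k` (`midE` canon) and `b̄_k ≠ z_k`
((4.64) on a closed level).  Twin of `midECut_facts` (the lower-class clauses dropped).
[cite: FitznerVanDerHofstad2017, (4.58)–(4.60), (4.64) and §6.1 "Case b" (arXiv:1506.07977v2 pp. 41–42, 58–59)] -/
theorem JFacts.lowE_facts {ω : Fin (M + 3) → BondConfig (Site d)} {K₀ : Fin (M + 3) → Fin 6 → Set (Sym2 (Site d))}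
    (hF : JFacts M x b w t z a c τ ω K₀) (i i₀ : Fin (M + 1)) (hk : i₀.succ = i.castSucc) (hσ : (τ i).1 = true)
    {u₀ : Unit} {a' : Fin 3} (ha : a i.castSucc = Sum.inr u₀) (ha' : a i.succ = Sum.inl a')
    (hty : t i.castSucc ≠ (b i.succ).1) :
    a' = 2 ∧ z i.castSucc ≠ (b i.succ).1 ∧ w i.succ ≠ t i.castSucc ∧ (b i.castSucc).2 ≠ z i.castSucc := by
  have hc := hF.canon_midE i hσ ha'
  exact ⟨hF.exitClass_succ_eq_two_of_sharp i hσ ha' hty, fun h => hty (hc.1.1 h), hc.2.resolve_right hty,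
    hF.v_ne_z_of_closedL i i₀ hk ha⟩

end Facts

/-! ### B. The cores over a closed lower level -/

section Cores

variable (p : unitInterval) (M : ℕ) (x : Site d) (b : Fin (M + 2) → Site d × Site d) (w t z : Fin (M + 2) → Site d)
  (a : Fin (M + 2) → Fin 3 ⊕ Unit) (c : Fin 3 ⊕ Unit) (τ : Fin (M + 1) → Bool × Fin 3)

/-- **Core of the cut-through packages over a closed lower level** (grouping `glMidS12`): finitary events
`E0, E1, E3, E4` containing the witnesses of `b̄_k → w_{k+1}`, `w_{k+1} → t_k`, `t_k → u_{k+1}`, `z_k → u_{k+1}`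
(the sausage loop, slot `2`, carries the sure event; the closed lower level owns no active slot) and bounds of the two
letters `xb ≤ T₁`, `up 2 ≤ T₂` give a package with target `T₁ * T₂`.  Twin of `nonempty_jPkg_midECut_core`.
[cite: FitznerVanDerHofstad2017, §6.1 (6.4) (arXiv:1506.07977v2 p. 58); §4.4 (4.58)–(4.60), (4.65) (pp. 41, 43)] -/
theorem nonempty_jPkg_lowECut_core (i i₀ : Fin (M + 1)) (hk : i₀.succ = i.castSucc) (κ : Fin d × Bool)
    (hb : (b i.castSucc).2 = (b i.castSucc).1 + stepVec κ) (hσ : (τ i).1 = true) {u₀ : Unit} {a' : Fin 3}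
    (ha : a i.castSucc = Sum.inr u₀) (ha' : a i.succ = Sum.inl a') (E0 E1 E3 E4 : Set (BondConfig (Site d)))
    (h0 : IsFinitary E0) (h1 : IsFinitary E1) (h3 : IsFinitary E3) (h4 : IsFinitary E4)
    (hmem : ∀ ω K₀, JFacts M x b w t z a c τ ω K₀ →
      K₀ i.castSucc.succ 0 ∈ E0 ∧ K₀ i.castSucc.succ 1 ∈ E1 ∧ K₀ i.castSucc.succ 3 ∈ E3 ∧
        K₀ i.castSucc.succ 4 ∈ E4)
    {T₁ T₂ : ℝ≥0∞}
    (hrow₁ : junF p M x b w t z a τ i.castSucc glMidS12 true false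
      (midEv (event (eq 1) (b i.castSucc).1 (b i.castSucc).2) E0 E1 Set.univ E3 E4 Set.univ) .xb ≤ T₁)
    (hrow₂ : junF p M x b w t z a τ i.castSucc glMidS12 true false
      (midEv (event (eq 1) (b i.castSucc).1 (b i.castSucc).2) E0 E1 Set.univ E3 E4 Set.univ) (.up 2) ≤ T₂) :
    Nonempty (JPkg p (jctx M x b w t z a τ i.castSucc) (JFacts M x b w t z a c τ) (T₁ * T₂)) := by
  have huv : (b i.castSucc).1 ≠ (b i.castSucc).2 := by
    rw [hb]; exact (zdGraph_adj_iff_stepVec _ _ |>.2 ⟨κ, rfl⟩).ne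
  refine nonempty_jPkg_of_joint p i.castSucc glMidS12 true
    (midEv (event (eq 1) (b i.castSucc).1 (b i.castSucc).2) E0 E1 Set.univ E3 E4 Set.univ)
    (isFinitary_midEv _ _ _ _ _ _ _ (isFinitary_event _ _ _) h0 h1 isFinitary_univ h3 h4 isFinitary_univ)
    (fun _ => by rw [midEv_xb]; exact singleton_mem_event_eq_one huv)
    (fun j j' _ _ hg => glMidS12_entry_midE M x b w t z a τ i hσ ha' j j' hg)
    (fun ω K₀ hF => ⟨fun j hj => ?_, fun j hj => ?_⟩) ?_
  · -- a closed lower level owns no active slot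
    exact absurd hj (jClosedL_not_act_lo M x b w t z a τ i i₀ hk ha true false j)
  · -- the witnesses of level `k + 1`
    have hj5 : j ≠ 5 := (jMidE_act_up_iff M x b w t z a τ i hσ ha' true false j).1 hj
    obtain ⟨m0, m1, m3, m4⟩ := hmem ω K₀ hF
    exact mem_midEv_up _ _ _ _ _ _ _ m0 m1 (Set.mem_univ _) m3 m4 j hj5
  · -- two genuine letters
    exact (prod_junF_le₂ p M x b w t z a τ i.castSucc glMidS12 true false _
      (show JIdx.xb ≠ JIdx.up 2 by decide)).trans (mul_le_mul' hrow₁ hrow₂)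

/-- **Core, pentagon grouping, over a closed lower level**: upgraded events for the five lines of level `k + 1`
containing the joint witnesses, a bond event `EB ∋ {b_k}`, and bounds of the letters `xb ≤ T₁`, `up 3 ≤ T₂` give a
package with target `T₁ * T₂`.  Twin of `nonempty_jPkg_midEP_core`.
[cite: FitznerVanDerHofstad2017, §6.1 (6.4) (arXiv:1506.07977v2 p. 58); §4.4 (4.58)–(4.60), (4.65) (pp. 41, 43)] -/
theorem nonempty_jPkg_lowEP_core (i i₀ : Fin (M + 1)) (hk : i₀.succ = i.castSucc) (hσ : (τ i).1 = true)
    {u₀ : Unit} {a' : Fin 3} (ha : a i.castSucc = Sum.inr u₀) (ha' : a i.succ = Sum.inl a')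
    (EB E0 E1 E2 E3 E4 : Set (BondConfig (Site d))) (hfB : IsFinitary EB) (h0 : IsFinitary E0)
    (h1 : IsFinitary E1) (h2 : IsFinitary E2) (h3 : IsFinitary E3) (h4 : IsFinitary E4)
    (hB : ({s((b i.castSucc).1, (b i.castSucc).2)} : Set (Sym2 (Site d))) ∈ EB)
    (hmem : ∀ ω K₀, JFacts M x b w t z a c τ ω K₀ →
      K₀ i.castSucc.succ 0 ∈ E0 ∧ K₀ i.castSucc.succ 1 ∈ E1 ∧ K₀ i.castSucc.succ 2 ∈ E2 ∧
        K₀ i.castSucc.succ 3 ∈ E3 ∧ K₀ i.castSucc.succ 4 ∈ E4)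
    {T₁ T₂ : ℝ≥0∞}
    (hrow₁ : junF p M x b w t z a τ i.castSucc glMidP true false (midEv EB E0 E1 E2 E3 E4 Set.univ) .xb ≤ T₁)
    (hrow₂ : junF p M x b w t z a τ i.castSucc glMidP true false (midEv EB E0 E1 E2 E3 E4 Set.univ) (.up 3) ≤
      T₂) :
    Nonempty (JPkg p (jctx M x b w t z a τ i.castSucc) (JFacts M x b w t z a c τ) (T₁ * T₂)) := by
  refine nonempty_jPkg_of_joint p i.castSucc glMidP true (midEv EB E0 E1 E2 E3 E4 Set.univ)
    (isFinitary_midEv _ _ _ _ _ _ _ hfB h0 h1 h2 h3 h4 isFinitary_univ) (fun _ => by rw [midEv_xb]; exact hB)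
    (fun j j' _ _ hg => glMidP_entry_midE M x b w t z a τ i hσ ha' j j' hg)
    (fun ω K₀ hF => ⟨fun j hj => ?_, fun j hj => ?_⟩) ?_
  · exact absurd hj (jClosedL_not_act_lo M x b w t z a τ i i₀ hk ha true false j)
  · have hj5 : j ≠ 5 := (jMidE_act_up_iff M x b w t z a τ i hσ ha' true false j).1 hj
    obtain ⟨m0, m1, m2, m3, m4⟩ := hmem ω K₀ hF
    exact mem_midEv_up _ _ _ _ _ _ _ m0 m1 m2 m3 m4 j hj5
  · exact (prod_junF_le₂ p M x b w t z a τ i.castSucc glMidP true false _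
      (show JIdx.xb ≠ JIdx.up 3 by decide)).trans (mul_le_mul' hrow₁ hrow₂)

/-- **Core of the `d = 1` rows over a closed lower level**: events for the five lines of level `k + 1`, the bond
`b_k` and the sausage bond (slot `xtz`); on the piece `t_k ~ z_k` and the sausage witness is the bond; and the letter
estimate `junF xb · junF (up 3) ≤ p · tgt`.  Then a package with target `tgt` exists (`nonempty_jPkg_of_joint_tz`).
Twin of `nonempty_jPkg_midEPT_core`.
[cite: FitznerVanDerHofstad2017, §6.1 (6.4), "Case b = 1" (arXiv:1506.07977v2 pp. 58–59); App. B Table "B^{(2),ι,a,b}" rows d = 1 (p. 76); §4.4 (4.65) (p. 43)] -/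
theorem nonempty_jPkg_lowEPT_core (i i₀ : Fin (M + 1)) (hk : i₀.succ = i.castSucc) (hσ : (τ i).1 = true)
    {u₀ : Unit} {a' : Fin 3} (ha : a i.castSucc = Sum.inr u₀) (ha' : a i.succ = Sum.inl a')
    (EB E0 E1 E2 E3 E4 ET : Set (BondConfig (Site d))) (hfB : IsFinitary EB) (h0 : IsFinitary E0)
    (h1 : IsFinitary E1) (h2 : IsFinitary E2) (h3 : IsFinitary E3) (h4 : IsFinitary E4) (hfT : IsFinitary ET)
    (hB : ({s((b i.castSucc).1, (b i.castSucc).2)} : Set (Sym2 (Site d))) ∈ EB)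
    (hT : ({s(t i.castSucc, z i.castSucc)} : Set (Sym2 (Site d))) ∈ ET)
    (hfacts : ∀ ω K₀, JFacts M x b w t z a c τ ω K₀ →
      (zdGraph d).Adj (t i.castSucc) (z i.castSucc) ∧ K₀ i.castSucc.succ 2 = {s(t i.castSucc, z i.castSucc)})
    (hmem : ∀ ω K₀, JFacts M x b w t z a c τ ω K₀ →
      K₀ i.castSucc.succ 0 ∈ E0 ∧ K₀ i.castSucc.succ 1 ∈ E1 ∧ K₀ i.castSucc.succ 2 ∈ E2 ∧
        K₀ i.castSucc.succ 3 ∈ E3 ∧ K₀ i.castSucc.succ 4 ∈ E4)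
    {tgt : ℝ≥0∞}
    (hrow : junF p M x b w t z a τ i.castSucc glMidPT true true (midEvT EB E0 E1 E2 E3 E4 Set.univ ET) .xb *
        junF p M x b w t z a τ i.castSucc glMidPT true true (midEvT EB E0 E1 E2 E3 E4 Set.univ ET) (.up 3) ≤
      ENNReal.ofReal p * tgt) :
    Nonempty (JPkg p (jctx M x b w t z a τ i.castSucc) (JFacts M x b w t z a c τ) tgt) := by
  refine nonempty_jPkg_of_joint_tz p i.castSucc glMidPT true (midEvT EB E0 E1 E2 E3 E4 Set.univ ET)
    (isFinitary_midEvT _ _ _ _ _ _ _ _ hfB h0 h1 h2 h3 h4 isFinitary_univ hfT)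
    (fun _ => by rw [midEvT_xb]; exact hB) (by rw [midEvT_xtz]; exact hT)
    (fun ω K₀ hF => ⟨(hfacts ω K₀ hF).1.ne, (SimpleGraph.mem_edgeSet _).2 (hfacts ω K₀ hF).1⟩)
    (fun _ ω K₀ hF => hF.bK_ne_tzB_midE i hσ ha')
    (fun j j' _ _ hg => glMidPT_entry_midE M x b w t z a τ i hσ ha' j j' hg)
    (fun ω K₀ hF j _ hg hm => ?_) (fun ω K₀ hF => ⟨fun j hj => ?_, fun j hj => ?_⟩) ?_
  · -- the triangle witnesses avoid the sausage bond
    have hj2 : j ≠ 2 := glMidPT_up_ne_two_of_eq_xtz hg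
    have hw2 := (hfacts ω K₀ hF).2
    exact Set.disjoint_left.1 (hF.disj i.castSucc.succ 2 j hj2.symm) (by rw [hw2]; exact Set.mem_singleton _) hm
  · exact absurd hj (jClosedL_not_act_lo M x b w t z a τ i i₀ hk ha true true j)
  · have hj5 : j ≠ 5 := (jMidE_act_up_iff M x b w t z a τ i hσ ha' true true j).1 hj
    obtain ⟨m0, m1, m2, m3, m4⟩ := hmem ω K₀ hF
    exact mem_midEvT_up _ _ _ _ _ _ _ _ m0 m1 m2 m3 m4 j hj5
  · exact (prod_junF_le₂ p M x b w t z a τ i.castSucc glMidPT true true _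
      (show JIdx.xb ≠ JIdx.up 3 by decide)).trans hrow

/-- **The letters of the `d = 1` row over a closed lower level** (pin `z_k = w_k`): with the natural events,
`junF xb · junF (up 3) ≤ p · (p⁻¹ · T · P)` where `T = T_{≥1,≥1,1̲}(u′−t, z−t, 0)` and
`P = P_{1̲,≥0,≥1,1̲,≥0}(b̄−u, w′−u, t−u, z−u, w−u)` — the pentagon letter is read on its four upper lines and the
trivially witnessed `{z ↔ w}` is added as fifth line.  Twin of `junF_midEPT_mul_le`.
[cite: FitznerVanDerHofstad2017, App. B Table "B^{(2),ι,a,b}" row a ≥ 2, d = 1, "Ā = p⁻¹A"-type refund (arXiv:1506.07977v2 pp. 76, 78); §4.2 (4.17)–(4.18) (pp. 35–36)] -/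
theorem junF_lowEPT_mul_le (i : Fin (M + 1)) (κ : Fin d × Bool)
    (hb : (b i.castSucc).2 = (b i.castSucc).1 + stepVec κ) (hσ : (τ i).1 = true)
    {a' : Fin 3} (ha' : a i.succ = Sum.inl a') (hzw : z i.castSucc = w i.castSucc)
    (E3 E4 : Set (BondConfig (Site d))) (hE3 : E3 = event (ge 1) (t i.castSucc) (b i.succ).1)
    (hE4 : E4 = event (ge 1) (b i.succ).1 (z i.castSucc)) :
    junF p M x b w t z a τ i.castSucc glMidPT true true
        (midEvT (event (eq 1) (b i.castSucc).1 (b i.castSucc).2) (event (ge 0) (b i.castSucc).2 (w i.succ))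
          (event (ge 1) (w i.succ) (t i.castSucc)) (event (eq 1) (t i.castSucc) (z i.castSucc)) E3 E4
          Set.univ (event (eq 1) (z i.castSucc) (t i.castSucc))) .xb *
      junF p M x b w t z a τ i.castSucc glMidPT true true
        (midEvT (event (eq 1) (b i.castSucc).1 (b i.castSucc).2) (event (ge 0) (b i.castSucc).2 (w i.succ))
          (event (ge 1) (w i.succ) (t i.castSucc)) (event (eq 1) (t i.castSucc) (z i.castSucc)) E3 E4
          Set.univ (event (eq 1) (z i.castSucc) (t i.castSucc))) (.up 3) ≤
      ENNReal.ofReal p * ((ENNReal.ofReal p)⁻¹ *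
        ((Letters.perc d p).T (ge 1) (ge 1) (eq 1) ((b i.succ).1 - t i.castSucc) (z i.castSucc - t i.castSucc) 0 *
          (Letters.perc d p).P (eq 1) (ge 0) (ge 1) (eq 1) (ge 0) ((b i.castSucc).2 - (b i.castSucc).1)
            (w i.succ - (b i.castSucc).1) (t i.castSucc - (b i.castSucc).1) (z i.castSucc - (b i.castSucc).1)
            (w i.castSucc - (b i.castSucc).1))) := by
  subst hE3 hE4
  have hed : s((b i.castSucc).1, (b i.castSucc).2) ∈ (zdGraph d).edgeSet :=
    (SimpleGraph.mem_edgeSet _).2 ((zdGraph_adj_iff_stepVec _ _).2 ⟨κ, hb⟩)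
  -- the pentagon letter on its four upper lines, plus the trivially witnessed `{z ↔ w}`
  have hxb := (junF_lowEPT_xb_le₄ p M x b w t z a τ i hσ ha'
    (event (eq 1) (b i.castSucc).1 (b i.castSucc).2) (event (ge 0) (b i.castSucc).2 (w i.succ))
    (event (ge 1) (w i.succ) (t i.castSucc)) (event (eq 1) (t i.castSucc) (z i.castSucc))
    (event (ge 1) (t i.castSucc) (b i.succ).1) (event (ge 1) (b i.succ).1 (z i.castSucc))
    Set.univ (event (eq 1) (z i.castSucc) (t i.castSucc))).trans
    (measure_mono (genDisjOcc_quad_subset_pent _ _ _ _ (event (ge 0) (z i.castSucc) (w i.castSucc))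
      (by rw [hzw]; exact empty_mem_event_ge_zero_self (w i.castSucc)) (0 : Fin 2) 1 1 1 0))
  have hup := junF_midEPT_up_le₃ p M x b w t z a τ i hσ ha'
    (event (eq 1) (b i.castSucc).1 (b i.castSucc).2) (event (ge 0) (b i.castSucc).2 (w i.succ))
    (event (ge 1) (w i.succ) (t i.castSucc)) (event (eq 1) (t i.castSucc) (z i.castSucc))
    (event (ge 1) (t i.castSucc) (b i.succ).1) (event (ge 1) (b i.succ).1 (z i.castSucc))
    Set.univ (event (eq 1) (z i.castSucc) (t i.castSucc))
  have hP := piPerc_genDisjOcc_le_P p (eq 1) (ge 0) (ge 1) (eq 1) (ge 0) (b i.castSucc).1 (b i.castSucc).2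
    (w i.succ) (t i.castSucc) (z i.castSucc) (w i.castSucc) (![0, 1, 1, 1, 0] : Fin 5 → Fin 2)
  have hTt := piPerc_genDisjOcc_le_T p (ge 1) (ge 1) (eq 1) (t i.castSucc) (b i.succ).1 (z i.castSucc)
    (t i.castSucc) (![1, 1, 0] : Fin 3 → Fin 2)
  rw [sub_self] at hTt
  have hpb := piPerc_two_genDisjOcc_le_ofReal_of_bond p hed
    ![event (eq 1) (b i.castSucc).1 (b i.castSucc).2, event (ge 0) (b i.castSucc).2 (w i.succ),
      event (ge 1) (w i.succ) (t i.castSucc), event (eq 1) (t i.castSucc) (z i.castSucc),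
      event (ge 0) (z i.castSucc) (w i.castSucc)]
    (![0, 1, 1, 1, 0] : Fin 5 → Fin 2) 0 rfl
  refine le_ofReal_mul_inv_mul p ?_ ?_
  · exact (mul_le_mul' (hxb.trans hpb) (junF_le_one p M x b w t z a τ i.castSucc glMidPT true true _ _)).trans_eq
      (mul_one _)
  · exact (mul_le_mul' (hxb.trans hP) (hup.trans hTt)).trans_eq (mul_comm _ _)

end Cores

/-! ### C. The cells -/

section Packages

variable (p : unitInterval) (M : ℕ) (x : Site d) (b : Fin (M + 2) → Site d × Site d) (w t z : Fin (M + 2) → Site d)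
  (a : Fin (M + 2) → Fin 3 ⊕ Unit) (c : Fin 3 ⊕ Unit) (τ : Fin (M + 1) → Bool × Fin 3)


/-- **The cut-through cell `(★, ·, a′)` of a middle junction `k = i₀ + 1 ≤ M` over a closed level, variant `F″`
(`t_k ≠ u_{k+1}`), regime `z_k = t_k`, on the pin `z_k = w_k`, off the corner `w_{k+1} ~ t_k`**: a package with target
`A^{κ,2,a′}(u_k,w_k,w_{k+1},t_k) · P^{S,0}(u_{k+1} − t_k, u_{k+1} − t_k)`.  For `a′ ≤ 1` the piece is empty (clause
(8)); for `a′ = 2` the `A`-letter is row `(2,2)` of Table "A" with the trivially witnessed `{t ↔ w}` (`z = t = w`) and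
the `P^{S,0}`-letter is the double connection `t_k ⇔ u_{k+1}` of the last sausage.  Twin of `nonempty_jPkg_midE_cut`.
[cite: FitznerVanDerHofstad2017, §5.1 (5.4) second term (arXiv:1506.07977v2 p. 48); §6.1 (6.4), "Cases a ≥ 1 and b ≥ 1" (pp. 58–59); App. B (pp. 73, 75)] -/
theorem nonempty_jPkg_lowE_cut (i i₀ : Fin (M + 1)) (hk : i₀.succ = i.castSucc) (κ : Fin d × Bool)
    (hb : (b i.castSucc).2 = (b i.castSucc).1 + stepVec κ) (hσ : (τ i).1 = true) {u₀ : Unit}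
    (ha : a i.castSucc = Sum.inr u₀) {a' : Fin 3} (ha' : a i.succ = Sum.inl a')
    (hty : t i.castSucc ≠ (b i.succ).1) (hzt : z i.castSucc = t i.castSucc) (hzw : z i.castSucc = w i.castSucc)
    (hna : ¬ (zdGraph d).Adj (w i.succ) (t i.castSucc)) :
    Nonempty (JPkg p (jctx M x b w t z a τ i.castSucc) (JFacts M x b w t z a c τ)
      (blockAiota (Letters.perc d p) κ 2 a' (b i.castSucc).1 (w i.castSucc) (w i.succ) (t i.castSucc) *
        blockPS (Letters.perc d p) 0 ((b i.succ).1 - t i.castSucc) ((b i.succ).1 - t i.castSucc))) := by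
  -- exit class `a′ ≤ 1` above: the piece is empty (clause (8))
  by_cases h2 : a' = 2
  swap
  · exact nonempty_jPkg_of_sharp p c _ i hσ ha' h2 hty _
  subst h2
  -- degenerate parameters: the piece is empty
  by_cases hwt : w i.succ ≠ t i.castSucc
  swap
  · exact ⟨JPkg.vacuous p _ _
      (fun ω K₀ hF => hwt (hF.lowE_facts M x b w t z a c τ i i₀ hk hσ ha ha' hty).2.2.1) _⟩
  have htw : t i.castSucc = w i.castSucc := hzt.symm.trans hzw
  have h := nonempty_jPkg_lowECut_core p M x b w t z a c τ i i₀ hk κ hb hσ ha ha'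
    (event (ge 0) (b i.castSucc).2 (w i.succ)) (event (ge 2) (w i.succ) (t i.castSucc))
    (event (ge 0) (t i.castSucc) (b i.succ).1) (event (ge 0) (t i.castSucc) (b i.succ).1)
    (isFinitary_event _ _ _) (isFinitary_event _ _ _) (isFinitary_event _ _ _) (isFinitary_event _ _ _)
    (fun ω K₀ hF => ?_)
    (T₁ := blockAiota (Letters.perc d p) κ 2 2 (b i.castSucc).1 (w i.castSucc) (w i.succ) (t i.castSucc))
    (T₂ := blockPS (Letters.perc d p) 0 ((b i.succ).1 - t i.castSucc) ((b i.succ).1 - t i.castSucc)) ?_ ?_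
  · exact h
  · obtain ⟨h0, h1, -, h3, h4⟩ := hF.conn_midE i hσ ha'
    rw [hzt] at h4
    refine ⟨?_, ?_, ?_, ?_⟩
    · rw [event_ge]; exact mem_openConnGe_zero_of_mem h0
    · rw [event_ge]
      refine mem_openConnGe_two_of_notMem h1 hwt fun hm => hna ?_
      exact (SimpleGraph.mem_edgeSet _).1 (hF.lattice _ (hF.witness_subset _ 1 hm))
    · rw [event_ge]; exact mem_openConnGe_zero_of_mem h3
    · rw [event_ge]; exact mem_openConnGe_zero_of_mem h4
  · -- the `A`-letter: bond, `v → w′`, `w′ ⇐2⇒ t` (+ the trivially witnessed `t ↔ w`)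
    refine (junF_lowECut_xb_le₃ p M x b w t z a τ i hσ ha' _ _ _ _ _ _ _).trans ?_
    refine (measure_mono (genDisjOcc_triple_subset_quad _ _ _ (event (ge 0) (t i.castSucc) (w i.castSucc))
      (by rw [htw]; exact empty_mem_event_ge_zero_self (w i.castSucc)) 0 1 1 0)).trans ?_
    exact piPerc_midF1_two_two_le_blockAiota p hb ![0, 1, 1, 0]
  · -- the `P^{S,0}`-letter: the two routes of the last sausage
    refine (junF_midECut_up_le₂ p M x b w t z a τ i hσ ha' _ _ _ _ _ _ _).trans ?_
    rw [← blockPE_zero]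
    exact piPerc_end_zero_le_blockPE p rfl _ rfl

/-- **The cut-through cells over a closed level in the literal shape of TERM 2 of (5.4)**, primed `A^κ` family:
`δ_{z_k,t_k} · (A'^{κ,2,a′}(u_k,w_k,w_{k+1},t_k) · P^{S,0}(u_{k+1} − t_k, u_{k+1} − t_k))` (`a′ ≤ 1`: empty piece).
Twin of `nonempty_jPkg_midE_cut_term₂'`.
[cite: FitznerVanDerHofstad2017, §5.1 (5.4) second term (arXiv:1506.07977v2 p. 48); §6.1 (6.4) (pp. 58–59); App. B (pp. 73, 75)] -/
theorem nonempty_jPkg_lowE_cut_term₂' (i i₀ : Fin (M + 1)) (hk : i₀.succ = i.castSucc) (κ : Fin d × Bool)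
    (hb : (b i.castSucc).2 = (b i.castSucc).1 + stepVec κ) (hσ : (τ i).1 = true) {u₀ : Unit}
    (ha : a i.castSucc = Sum.inr u₀) {a' : Fin 3} (ha' : a i.succ = Sum.inl a')
    (hty : t i.castSucc ≠ (b i.succ).1) (hzt : z i.castSucc = t i.castSucc) (hzw : z i.castSucc = w i.castSucc)
    (hna : ¬ (zdGraph d).Adj (w i.succ) (t i.castSucc)) :
    Nonempty (JPkg p (jctx M x b w t z a τ i.castSucc) (JFacts M x b w t z a c τ)
      (kd (z i.castSucc) (t i.castSucc) *
        (blockAiota' (Letters.perc d p) κ 2 a' (b i.castSucc).1 (w i.castSucc) (w i.succ) (t i.castSucc) *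
          blockPS (Letters.perc d p) 0 ((b i.succ).1 - t i.castSucc) ((b i.succ).1 - t i.castSucc)))) := by
  by_cases h2 : a' = 2
  · subst h2
    rw [hzt, kd_self, one_mul, blockAiota'_of_ne (Letters.perc d p) κ (a := 2) (b := 2) fun h => absurd h.1 (by decide)]
    exact nonempty_jPkg_lowE_cut p M x b w t z a c τ i i₀ hk κ hb hσ ha ha' hty hzt hzw hna
  · exact nonempty_jPkg_of_sharp p c _ i hσ ha' h2 hty _

/-- **Row `(★ = ≥2, ≥2 | d = 1)` of `B^{(2)}` at a middle junction `k = i₀ + 1` over a closed level**, on the pin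
`z_k = w_k`: `t_k ≠ u_{k+1}` (`F″`), inner class `1`: target
`p⁻¹ · 2dD(z−t) · T_{≥1,≥1,1̲}(u′−t, z−t, 0) · P_{1̲,≥0,≥1,1̲,≥0}(b̄−u, w′−u, t−u, z−u, w−u)` (the last pentagon side
trivially witnessed); `a′ ≤ 1`: empty piece.  Twin of `nonempty_jPkg_midE_properTZ_two_two`.
[cite: FitznerVanDerHofstad2017, App. B Table "B^{(2),ι,a,b}", row a ≥ 2, b ≥ 2, d_{C̃}(w,u) = 1 (arXiv:1506.07977v2 p. 76); §5.1 (5.4) third term (p. 48); §6.1 "Case b = 1" (p. 59)] -/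
theorem nonempty_jPkg_lowE_properTZ_two_two (i i₀ : Fin (M + 1)) (hk : i₀.succ = i.castSucc) (κ : Fin d × Bool)
    (hb : (b i.castSucc).2 = (b i.castSucc).1 + stepVec κ) (hσ : (τ i).1 = true) (hc1 : (τ i).2 = 1)
    {u₀ : Unit} (ha : a i.castSucc = Sum.inr u₀) {a' : Fin 3} (ha' : a i.succ = Sum.inl a')
    (hty : t i.castSucc ≠ (b i.succ).1) (hzw : z i.castSucc = w i.castSucc) :
    Nonempty (JPkg p (jctx M x b w t z a τ i.castSucc) (JFacts M x b w t z a c τ)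
      ((Letters.perc d p).p⁻¹ * twoDD (z i.castSucc - t i.castSucc) *
        (Letters.perc d p).T (ge 1) (ge 1) (eq 1) ((b i.succ).1 - t i.castSucc) (z i.castSucc - t i.castSucc) 0 *
        (Letters.perc d p).P (eq 1) (ge 0) (ge 1) (eq 1) (ge 0) ((b i.castSucc).2 - (b i.castSucc).1)
          (w i.succ - (b i.castSucc).1) (t i.castSucc - (b i.castSucc).1) (z i.castSucc - (b i.castSucc).1)
          (w i.castSucc - (b i.castSucc).1))) := by
  by_cases h2 : a' = 2
  swap
  · exact nonempty_jPkg_of_sharp p c _ i hσ ha' h2 hty _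
  subst h2
  by_cases hP : z i.castSucc ≠ (b i.succ).1 ∧ w i.succ ≠ t i.castSucc ∧ (zdGraph d).Adj (t i.castSucc) (z i.castSucc)
  swap
  · refine ⟨JPkg.vacuous p _ _ (fun ω K₀ hF => hP ?_) _⟩
    obtain ⟨-, hzy, hwt, -⟩ := hF.lowE_facts M x b w t z a c τ i i₀ hk hσ ha ha' hty
    exact ⟨hzy, hwt, (hF.innerClass_one i hc1).2.2⟩
  obtain ⟨hzy, hwt, hadj⟩ := hP
  have htz : t i.castSucc ≠ z i.castSucc := hadj.ne
  obtain ⟨κ', hκ'⟩ := (zdGraph_adj_iff_stepVec _ _).1 hadj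
  have h2d : twoDD (z i.castSucc - t i.castSucc) = 1 := by rw [hκ', add_sub_cancel_left, twoDD_stepVec]
  have huv : (b i.castSucc).1 ≠ (b i.castSucc).2 := by
    rw [hb]; exact (zdGraph_adj_iff_stepVec _ _ |>.2 ⟨κ, rfl⟩).ne
  refine nonempty_jPkg_lowEPT_core p M x b w t z a c τ i i₀ hk hσ ha ha'
    (event (eq 1) (b i.castSucc).1 (b i.castSucc).2) (event (ge 0) (b i.castSucc).2 (w i.succ))
    (event (ge 1) (w i.succ) (t i.castSucc)) (event (eq 1) (t i.castSucc) (z i.castSucc))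
    (event (ge 1) (t i.castSucc) (b i.succ).1) (event (ge 1) (b i.succ).1 (z i.castSucc))
    (event (eq 1) (z i.castSucc) (t i.castSucc))
    (isFinitary_event _ _ _) (isFinitary_event _ _ _) (isFinitary_event _ _ _) (isFinitary_event _ _ _)
    (isFinitary_event _ _ _) (isFinitary_event _ _ _) (isFinitary_event _ _ _)
    (singleton_mem_event_eq_one huv) (by rw [event_comm]; exact singleton_mem_event_eq_one htz)
    (fun ω K₀ hF => ?_) (fun ω K₀ hF => ?_) ?_
  · have h1 := hF.innerClass_one i hc1
    exact ⟨h1.2.2, hF.tz_witness_midE i hσ ha' h1.2.2.ne h1.2.1⟩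
  · obtain ⟨h0, h1, -, h3, h4⟩ := hF.conn_midE i hσ ha'
    have h1' := hF.innerClass_one i hc1
    have hw2 := hF.tz_witness_midE i hσ ha' h1'.2.2.ne h1'.2.1
    refine ⟨?_, ?_, ?_, ?_, ?_⟩
    · rw [event_ge]; exact mem_openConnGe_zero_of_mem h0
    · rw [event_ge]; exact mem_openConnGe_one_of_ne h1 hwt
    · rw [hw2]; exact singleton_mem_event_eq_one htz
    · rw [event_ge]; exact mem_openConnGe_one_of_ne h3 hty
    · rw [event_comm, event_ge]; exact mem_openConnGe_one_of_ne h4 hzy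
  · rw [perc_p, h2d, mul_one, mul_assoc ((ENNReal.ofReal p)⁻¹)]
    exact junF_lowEPT_mul_le p M x b w t z a τ i κ hb hσ ha' hzw _ _ rfl rfl

/-- **Row `(★ = ≥2, ≥2 | d = 1)` in the literal base-`u_k` coordinates of `NobleBlocksNTPrime.blockBNTpt₀'`** (first
summand of `blockBNTpt₀'_two_two`; the target `tgtReg_true_one_two_two`).  Twin of
`nonempty_jPkg_midE_properTZ_two_two_lit`.
[cite: FitznerVanDerHofstad2017, App. B Table "B^{(2),ι,a,b}", row a ≥ 2, b ≥ 2, d = 1 (arXiv:1506.07977v2 p. 76); §5.1 (5.4) (p. 48)] -/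
theorem nonempty_jPkg_lowE_properTZ_two_two_lit (i i₀ : Fin (M + 1)) (hk : i₀.succ = i.castSucc)
    (κ : Fin d × Bool) (hb : (b i.castSucc).2 = (b i.castSucc).1 + stepVec κ) (hσ : (τ i).1 = true)
    (hc1 : (τ i).2 = 1) {u₀ : Unit} (ha : a i.castSucc = Sum.inr u₀) {a' : Fin 3} (ha' : a i.succ = Sum.inl a')
    (hty : t i.castSucc ≠ (b i.succ).1) (hzw : z i.castSucc = w i.castSucc) :
    Nonempty (JPkg p (jctx M x b w t z a τ i.castSucc) (JFacts M x b w t z a c τ)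
      ((Letters.perc d p).p⁻¹ * twoDD ((z i.castSucc - (b i.castSucc).1) - (t i.castSucc - (b i.castSucc).1)) *
        (Letters.perc d p).T (ge 1) (ge 1) (eq 1) (((b i.succ).1 - (b i.castSucc).1) - (t i.castSucc - (b i.castSucc).1))
          ((z i.castSucc - (b i.castSucc).1) - (t i.castSucc - (b i.castSucc).1)) 0 *
        (Letters.perc d p).P (eq 1) (ge 0) (ge 1) (eq 1) (ge 0) (stepVec κ) (w i.succ - (b i.castSucc).1)
          (t i.castSucc - (b i.castSucc).1) (z i.castSucc - (b i.castSucc).1) (w i.castSucc - (b i.castSucc).1))) := by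
  have he : (b i.castSucc).2 - (b i.castSucc).1 = stepVec κ := by rw [hb, add_sub_cancel_left]
  rw [sub_sub_sub_cancel_right, sub_sub_sub_cancel_right, ← he]
  exact nonempty_jPkg_lowE_properTZ_two_two p M x b w t z a c τ i i₀ hk κ hb hσ hc1 ha ha' hty hzw

/-- **Row `(★ = ≥2, ≥2 | d ≥ 2)` of `B^{(2)}` at a middle junction `k = i₀ + 1` over a closed level**, on the pin
`z_k = w_k`: `t_k ≠ u_{k+1}` (`F″`), inner class `2`: target
`B_{≥1,≥1}(u′−t, z−t) · P_{1̲,≥0,≥1,≥2,≥0}(b̄−u, w′−u, t−u, z−u, w−u)` (the last pentagon side trivially witnessed);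
`a′ ≤ 1`: empty piece.  Twin of `nonempty_jPkg_midE_proper_two_two`.
[cite: FitznerVanDerHofstad2017, App. B Table "B^{(2),ι,a,b}", row a ≥ 2, b ≥ 2, d_{C̃}(w,u) ≥ 2 (arXiv:1506.07977v2 p. 76); §5.1 (5.4) third term (p. 48); §6.1 "Cases a ≥ 1 and b ≥ 1" (p. 59)] -/
theorem nonempty_jPkg_lowE_proper_two_two (i i₀ : Fin (M + 1)) (hk : i₀.succ = i.castSucc) (κ : Fin d × Bool)
    (hb : (b i.castSucc).2 = (b i.castSucc).1 + stepVec κ) (hσ : (τ i).1 = true) (hc2 : (τ i).2 = 2)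
    {u₀ : Unit} (ha : a i.castSucc = Sum.inr u₀) {a' : Fin 3} (ha' : a i.succ = Sum.inl a')
    (hty : t i.castSucc ≠ (b i.succ).1) (hzw : z i.castSucc = w i.castSucc) :
    Nonempty (JPkg p (jctx M x b w t z a τ i.castSucc) (JFacts M x b w t z a c τ)
      ((Letters.perc d p).B (ge 1) (ge 1) ((b i.succ).1 - t i.castSucc) (z i.castSucc - t i.castSucc) *
        (Letters.perc d p).P (eq 1) (ge 0) (ge 1) (ge 2) (ge 0) ((b i.castSucc).2 - (b i.castSucc).1)
          (w i.succ - (b i.castSucc).1) (t i.castSucc - (b i.castSucc).1) (z i.castSucc - (b i.castSucc).1)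
          (w i.castSucc - (b i.castSucc).1))) := by
  -- exit class `a′ ≤ 1` above: the piece is empty (clause (8))
  by_cases h2 : a' = 2
  swap
  · exact nonempty_jPkg_of_sharp p c _ i hσ ha' h2 hty _
  subst h2
  -- degenerate parameters: the piece is empty
  by_cases hP : z i.castSucc ≠ (b i.succ).1 ∧ w i.succ ≠ t i.castSucc ∧ t i.castSucc ≠ z i.castSucc
  swap
  · refine ⟨JPkg.vacuous p _ _ (fun ω K₀ hF => hP ?_) _⟩
    obtain ⟨-, hzy, hwt, -⟩ := hF.lowE_facts M x b w t z a c τ i i₀ hk hσ ha ha' hty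
    exact ⟨hzy, hwt, hF.t_ne_z_of_innerClass_ne_zero i (by rw [hc2]; decide)⟩
  obtain ⟨hzy, hwt, htz⟩ := hP
  have huv : (b i.castSucc).1 ≠ (b i.castSucc).2 := by
    rw [hb]; exact (zdGraph_adj_iff_stepVec _ _ |>.2 ⟨κ, rfl⟩).ne
  rw [mul_comm]
  refine nonempty_jPkg_lowEP_core p M x b w t z a c τ i i₀ hk hσ ha ha'
    (event (eq 1) (b i.castSucc).1 (b i.castSucc).2) (event (ge 0) (b i.castSucc).2 (w i.succ))
    (event (ge 1) (w i.succ) (t i.castSucc)) (event (ge 2) (t i.castSucc) (z i.castSucc))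
    (event (ge 1) (t i.castSucc) (b i.succ).1) (event (ge 1) (b i.succ).1 (z i.castSucc))
    (isFinitary_event _ _ _) (isFinitary_event _ _ _) (isFinitary_event _ _ _) (isFinitary_event _ _ _)
    (isFinitary_event _ _ _) (isFinitary_event _ _ _)
    (singleton_mem_event_eq_one huv) (fun ω K₀ hF => ?_) ?_ ?_
  · obtain ⟨h0, h1, h2, h3, h4⟩ := hF.conn_midE i hσ ha'
    have hcl := (hF.innerClass_two i hc2).2
    refine ⟨?_, ?_, ?_, ?_, ?_⟩
    · rw [event_ge]; exact mem_openConnGe_zero_of_mem h0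
    · rw [event_ge]; exact mem_openConnGe_one_of_ne h1 hwt
    · rw [event_ge]
      exact mem_openConnGe_two_of_notMem h2 htz fun hm => hcl (hF.witness_subset _ 2 hm)
    · rw [event_ge]; exact mem_openConnGe_one_of_ne h3 hty
    · rw [event_comm, event_ge]; exact mem_openConnGe_one_of_ne h4 hzy
  · -- the pentagon on its four upper lines, plus the trivially witnessed `{z ↔ w}`
    refine (junF_lowEP_xb_le₄ p M x b w t z a τ i hσ ha' _ _ _ _ _ _ _).trans ?_
    refine (measure_mono (genDisjOcc_quad_subset_pent _ _ _ _ (event (ge 0) (z i.castSucc) (w i.castSucc))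
      (by rw [hzw]; exact empty_mem_event_ge_zero_self (w i.castSucc)) 0 1 1 1 0)).trans ?_
    exact piPerc_genDisjOcc_le_P p (eq 1) (ge 0) (ge 1) (ge 2) (ge 0) _ _ _ _ _ _ _
  · exact (junF_midEP_up_le₂ p M x b w t z a τ i hσ ha' _ _ _ _ _ _ _).trans
      (piPerc_genDisjOcc_le_B p (ge 1) (ge 1) _ _ _ _)

/-- **Row `(★ = ≥2, ≥2 | d ≥ 2)` in the literal base-`u_k` coordinates of `NobleBlocksNTPrime.blockBNTpt₀'`**
(second summand of `blockBNTpt₀'_two_two`; the target `tgtReg_true_two_two_two`).  Twin of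
`nonempty_jPkg_midE_proper_two_two_lit`.
[cite: FitznerVanDerHofstad2017, App. B Table "B^{(2),ι,a,b}", row a ≥ 2, b ≥ 2, d ≥ 2 (arXiv:1506.07977v2 p. 76); §5.1 (5.4) (p. 48)] -/
theorem nonempty_jPkg_lowE_proper_two_two_lit (i i₀ : Fin (M + 1)) (hk : i₀.succ = i.castSucc)
    (κ : Fin d × Bool) (hb : (b i.castSucc).2 = (b i.castSucc).1 + stepVec κ) (hσ : (τ i).1 = true)
    (hc2 : (τ i).2 = 2) {u₀ : Unit} (ha : a i.castSucc = Sum.inr u₀) {a' : Fin 3} (ha' : a i.succ = Sum.inl a')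
    (hty : t i.castSucc ≠ (b i.succ).1) (hzw : z i.castSucc = w i.castSucc) :
    Nonempty (JPkg p (jctx M x b w t z a τ i.castSucc) (JFacts M x b w t z a c τ)
      ((Letters.perc d p).B (ge 1) (ge 1) (((b i.succ).1 - (b i.castSucc).1) - (t i.castSucc - (b i.castSucc).1))
          ((z i.castSucc - (b i.castSucc).1) - (t i.castSucc - (b i.castSucc).1)) *
        (Letters.perc d p).P (eq 1) (ge 0) (ge 1) (ge 2) (ge 0) (stepVec κ) (w i.succ - (b i.castSucc).1)
          (t i.castSucc - (b i.castSucc).1) (z i.castSucc - (b i.castSucc).1) (w i.castSucc - (b i.castSucc).1))) := by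
  have he : (b i.castSucc).2 - (b i.castSucc).1 = stepVec κ := by rw [hb, add_sub_cancel_left]
  rw [sub_sub_sub_cancel_right, sub_sub_sub_cancel_right, ← he]
  exact nonempty_jPkg_lowE_proper_two_two p M x b w t z a c τ i i₀ hk κ hb hσ hc2 ha ha' hty hzw

/-! ### D. The slot `hE` of `nonempty_jPkg_mid_starL`, discharged up to the corner -/

/-- **The `F″` slot of the lower-`★` dispatcher, discharged up to the corner**: for a middle junction
`k = i₀ + 1 ≤ M` over a closed level with upper class `a′ = 2`, kind bit `true`, `t_k ≠ u_{k+1}` (and `z_k = t_k` if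
the inner class is `0`), a package with target `tgtStarL (Letters.perc d p) κ a′ (u_k,w_k,t_k,z_k,w_{k+1},u_{k+1}) (τ i)` — off the
pin `z_k = w_k` the piece is empty (`nonempty_jPkg_of_closedL_of_ne`); on it the target is row `a = 2` of `tgtReg`
(`tgtStarL_of_eq`): inner class `0` → `tgtReg_true_zero` and `nonempty_jPkg_lowE_cut_term₂'` OFF the corner
`w_{k+1} ~ t_k`, the corner itself being the residual HYPOTHESIS SLOT `hRS` (region `R` of DIVERGENCE D77, nothing
claimed); inner class `1` → `tgtReg_true_one_two_two` and `nonempty_jPkg_lowE_properTZ_two_two_lit`; inner class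
`2` → `tgtReg_true_two_two_two` and `nonempty_jPkg_lowE_proper_two_two_lit`.  This is literally the hypothesis
`hE` of `NobleBoundsNDispatchStarL.nonempty_jPkg_mid_starL`, given `hRS`.
[cite: FitznerVanDerHofstad2017, §6.1 (6.4) and "Case a ≥ 2" × "Case b", "Case b = 1" (arXiv:1506.07977v2 pp. 58–59); §5.1 (5.4) (p. 48); App. B (pp. 73, 75, 76)] -/
theorem nonempty_jPkg_lowE_slot (i i₀ : Fin (M + 1)) (hk : i₀.succ = i.castSucc) (κ : Fin d × Bool)
    (hb : (b i.castSucc).2 = (b i.castSucc).1 + stepVec κ) {u₀ : Unit} (ha : a i.castSucc = Sum.inr u₀)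
    (a' : Fin 3) (ha' : a i.succ = Sum.inl a') (hσ : (τ i).1 = true) (ha'2 : a' = 2)
    (hty : t i.castSucc ≠ (b i.succ).1) (hc0 : (τ i).2 = 0 → z i.castSucc = t i.castSucc)
    (hRS : (τ i).2 = 0 → z i.castSucc = t i.castSucc → z i.castSucc = w i.castSucc →
      (zdGraph d).Adj (w i.succ) (t i.castSucc) →
      Nonempty (JPkg p (jctx M x b w t z a τ i.castSucc) (JFacts M x b w t z a c τ)
        (tgtStarL (Letters.perc d p) κ a' (b i.castSucc).1 (w i.castSucc) (t i.castSucc) (z i.castSucc) (w i.succ) (b i.succ).1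
          (τ i)))) :
    Nonempty (JPkg p (jctx M x b w t z a τ i.castSucc) (JFacts M x b w t z a c τ)
      (tgtStarL (Letters.perc d p) κ a' (b i.castSucc).1 (w i.castSucc) (t i.castSucc) (z i.castSucc) (w i.succ) (b i.succ).1
        (τ i))) := by
  -- off the pinned section the piece is empty
  by_cases hzw : z i.castSucc = w i.castSucc
  swap
  · exact nonempty_jPkg_of_closedL_of_ne p M x b w t z a c τ i i₀ hk ha hzw _
  have h3 : ∀ e : Fin 3, e = 0 ∨ e = 1 ∨ e = 2 := by decide
  rcases h3 (τ i).2 with hc | hc | hc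
  · -- inner class `0`: cut-through off the corner, the slot `hRS` on it
    by_cases hadj : (zdGraph d).Adj (w i.succ) (t i.castSucc)
    · exact hRS hc (hc0 hc) hzw hadj
    · have hv : τ i = (true, 0) := Prod.ext hσ hc
      rw [tgtStarL_of_eq (Letters.perc d p) κ a' _ _ _ _ _ _ hzw, hv, tgtReg_true_zero]
      exact nonempty_jPkg_lowE_cut_term₂' p M x b w t z a c τ i i₀ hk κ hb hσ ha ha' hty (hc0 hc) hzw hadj
  · -- inner class `1`: row `d = 1`
    subst ha'2
    have hv : τ i = (true, 1) := Prod.ext hσ hc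
    rw [tgtStarL_of_eq (Letters.perc d p) κ 2 _ _ _ _ _ _ hzw, hv, tgtReg_true_one_two_two]
    exact nonempty_jPkg_lowE_properTZ_two_two_lit p M x b w t z a c τ i i₀ hk κ hb hσ hc ha ha' hty hzw
  · -- inner class `2`: row `d ≥ 2`
    subst ha'2
    have hv : τ i = (true, 2) := Prod.ext hσ hc
    rw [tgtStarL_of_eq (Letters.perc d p) κ 2 _ _ _ _ _ _ hzw, hv, tgtReg_true_two_two_two]
    exact nonempty_jPkg_lowE_proper_two_two_lit p M x b w t z a c τ i i₀ hk κ hb hσ hc ha ha' hty hzw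

/-! ### E. The lower-`★` pair package up to the two D77 residues -/

/-- **THE LOWER-`★` PAIR PACKAGE OF A MIDDLE JUNCTION, up to the D77 residues**: for a middle junction
`k = i₀ + 1 ≤ M` over a closed level with regular upper class `a′`, a package with target
`tgtStarL (Letters.perc d p) κ a′ (u_k,w_k,t_k,z_k,w_{k+1},u_{k+1}) (τ i)` for EVERY variant `τ i`, given only the two residual slots
`hR'` (`σ = false`, `a′ ≠ 0`, `w_{k+1} = t_k`) and `hRS` (`σ = true`, inner class `0`, `a′ = 2`, `t_k ≠ u_{k+1}`,
`z_k = t_k = w_k`, `w_{k+1} ~ t_k`) — `nonempty_jPkg_mid_starL` with `hF1 := nonempty_jPkg_lowF1_slot` and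
`hE := nonempty_jPkg_lowE_slot`.  This is the shape of the hypothesis `hML` of
`NobleBoundsNDispatchAll.nonempty_jPkg_all` up to the residues.
[cite: FitznerVanDerHofstad2017, §6.1 (6.4) and "Case a" × "Case b" (arXiv:1506.07977v2 pp. 58–59); §5.1 (5.4) (p. 48) and "Elements of the bounds" (p. 49); App. B (pp. 73–76)] -/
theorem nonempty_jPkg_mid_starL' (i i₀ : Fin (M + 1)) (hk : i₀.succ = i.castSucc) (κ : Fin d × Bool)
    (hb : (b i.castSucc).2 = (b i.castSucc).1 + stepVec κ) {u₀ : Unit} (ha : a i.castSucc = Sum.inr u₀)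
    (a' : Fin 3) (ha' : a i.succ = Sum.inl a')
    (hR' : (τ i).1 = false → a' ≠ 0 → w i.succ = t i.castSucc →
      Nonempty (JPkg p (jctx M x b w t z a τ i.castSucc) (JFacts M x b w t z a c τ)
        (tgtStarL (Letters.perc d p) κ a' (b i.castSucc).1 (w i.castSucc) (t i.castSucc) (z i.castSucc) (w i.succ) (b i.succ).1
          (τ i))))
    (hRS : (τ i).1 = true → (τ i).2 = 0 → a' = 2 → t i.castSucc ≠ (b i.succ).1 →
      z i.castSucc = t i.castSucc → z i.castSucc = w i.castSucc → (zdGraph d).Adj (w i.succ) (t i.castSucc) →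
      Nonempty (JPkg p (jctx M x b w t z a τ i.castSucc) (JFacts M x b w t z a c τ)
        (tgtStarL (Letters.perc d p) κ a' (b i.castSucc).1 (w i.castSucc) (t i.castSucc) (z i.castSucc) (w i.succ) (b i.succ).1
          (τ i)))) :
    Nonempty (JPkg p (jctx M x b w t z a τ i.castSucc) (JFacts M x b w t z a c τ)
      (tgtStarL (Letters.perc d p) κ a' (b i.castSucc).1 (w i.castSucc) (t i.castSucc) (z i.castSucc) (w i.succ) (b i.succ).1
        (τ i))) :=
  nonempty_jPkg_mid_starL p M x b w t z a c τ i i₀ hk κ hb ha a' ha' hR'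
    (fun hσ hc hty => nonempty_jPkg_lowF1_slot p M x b w t z a c τ i i₀ hk κ hb ha a' ha' hσ hc hty)
    (fun hσ ha'2 hty hc0 => nonempty_jPkg_lowE_slot p M x b w t z a c τ i i₀ hk κ hb ha a' ha' hσ ha'2 hty hc0
      fun hc hzt hzw hadj => hRS hσ hc ha'2 hty hzt hzw hadj)

end Packages

end Literature.Probability.FitznerVanDerHofstad2017

end
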